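import Literature.AnabelianGeometry.EtaleTheta.Discharge.Sec1Prop15Schema
import HarnessLib

/-!
# [EtTh] Prop. 1.5 (ii) as typed (`ThetaSetting.Prop15ii`): its universal closure ALONE reduces to the
# non-existence of Kummer data (FACT-LIST row F-2503, completing `Sec1Prop15Schema.lean`; proof-only)

Mochizuki, *The étale theta function …*, Publ. RIMS **45** (2009) [EtTh], §1, Prop. 1.5 (ii), PRIMS PDF p. 23
[cite: MochizukiEtTh2009, Prop 1.5 (ii) p.23]: "`F̈² = H¹(G_K̈, Δ_Θ) →̃ H¹(G_K̈, Ẑ(1)) →̃ (K̈^×)^∧`".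

PROOF-ONLY file (abc-iut cell, block F fact-proving wave, seat abc-iut-f-117; FACT-LIST row **F-2503**
`Literature.AnabelianGeometry.EtaleTheta.ThetaSetting.Prop15ii`).  `Sec1Prop15Schema.lean` reduced the closure
of Prop. 1.5 (ii) as typed only JOINTLY with (i) (`exists_not_prop15ii_of_exists_prop15i`), recording that a twist of
`log(Ü)` alone is not available.  This file removes that caveat by twisting the OTHER field the clause
`Fdd2_eq : F̈² = kumYdd.range` speaks about: if (ii) holds for a Kummer datum `K`, enlarge `(K̈^×)^∧` to
`(K̈^×)^∧ × ℤ` and extend `kumYdd` by `n ↦ dⁿ`, `d` a lift of `log(Θ)` to `H¹((Π^tp_Ÿ)^Θ, Δ_Θ)` supplied by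
(ii)'s OWN surjectivity `F̈⁰ ↠ Hom(Δ_Θ, Δ_Θ)`.  The extension is still injective — `kumYdd.range = F̈² ⊆ F̈¹`
restricts to `1` on `Δ_Θ` while `dⁿ` restricts to `log(Θ)ⁿ ≠ 1` for `n ≠ 0` (`H¹(Δ_Θ, Δ_Θ)` is TORSION-FREE
under the origin guard, `logTheta_zpow_eq_one_iff`) — and `K^×`, `log(U)`, `log(Ü)` are untouched, so all
interface axioms survive; but the new range contains `d ∉ F̈¹ ⊇ F̈²`, so (ii) FAILS for the enlarged datum:

* `ContH1.eq_one_of_pow_eq_one_of_conj_trivial` — no `n`-torsion in `H¹(H, A)` for a trivial action on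
  `n`-torsion-free `A` (abc-iut-w5-d171's `n = 2` lemma, verbatim for all `n`);
* `logTheta_pow_ne_one`, `logTheta_zpow_eq_one_iff` — `log(Θ)` has infinite order in `H¹(Δ_Θ, Δ_Θ)`;
* `KummerData.exists_kummerData_not_prop15ii` — the enlarged datum; hence
  **`forall_prop15ii_iff_isEmpty_kummerData : (∀ K, Prop15ii K hC) ↔ IsEmpty D.KummerData`** (guarded) and the
  guarded full closure `forall_prop15ii_iff_forall_isEmpty_kummerData`.

CONTENT READING: the interface `KummerData` lets `(K̈^×)^∧` be ANY group through which `K̈^×` injects into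
`H¹((Π^tp_Ÿ)^Θ, Δ_Θ)`; "(ii): its image is exactly `F̈²`" is therefore a genuine constraint (it pins `(K̈^×)^∧`
down as `F̈² = H¹(G_K̈, Δ_Θ)`), refutable over any setting with Kummer data and vacuous at the root model
(`model_forall_prop15ii`, companion file).  HONEST FRAMING: statements about the TYPED predicate; nothing of
[EtTh] is asserted or denied; no side is taken on [IUTchIII] Cor. 3.12; typed ≠ proved.  No definitions, no
instances, no Prop facts.
-/

noncomputable section

namespace Literature.AnabelianGeometry.EtaleTheta

open Literature.AnabelianGeometry.SemiGraphs
open scoped IsMulCommutative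

/-! ### Generic: no `n`-torsion in `H¹` for a trivial action on `n`-torsion-free coefficients -/

namespace ContH1

variable {G G' : Type*} [Group G] [TopologicalSpace G]
  [Group G'] [TopologicalSpace G'] [IsTopologicalGroup G']
  {φ : G →* G'} {A : Subgroup G'} [A.Normal] [IsMulCommutative A] {H : Subgroup G}

/-- If `H` acts TRIVIALLY on `A` through `φ` and `A` has no `n`-torsion, then `H¹(H, A)` has no `n`-torsion:
a cocycle `f` with `[f]ⁿ = 1` satisfies `f(h)ⁿ = ∂a(h) = 1` pointwise, hence `f = 1` (abc-iut-w5-d171's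
`eq_one_of_sq_eq_one_of_conj_trivial` for every exponent). [cite: NeukirchSchmidtWingberg2008, I §2] -/
theorem eq_one_of_pow_eq_one_of_conj_trivial {n : ℕ}
    (htriv : ∀ (h : H) (a : A), MulAut.conjNormal (φ (h : G)) a = a)
    (hA : ∀ a : A, a ^ n = 1 → a = 1) (x : ContH1 φ A H) (hx : x ^ n = 1) : x = 1 := by
  induction x using QuotientGroup.induction_on with
  | H f =>
    have hfn : f ^ n ∈ (contCoboundaries φ A H).subgroupOf (contCocycles φ A H) := by
      rw [← QuotientGroup.eq_one_iff]
      exact hx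
    rw [Subgroup.mem_subgroupOf, mem_contCoboundaries_iff] at hfn
    obtain ⟨a, ha⟩ := hfn
    have hf1 : f = 1 := by
      apply Subtype.ext
      funext h
      have h1 := congrFun ha h
      rw [htriv h a, mul_inv_cancel] at h1
      have h2 : f.1 h ^ n = 1 := by simpa using h1
      simpa using hA _ h2
    rw [hf1]
    rfl

end ContH1

namespace ThetaSetting

variable {p : ℕ} [Fact p.Prime] {D : ThetaSetting p}

/-! ### `log(Θ)` has infinite order in `H¹(Δ_Θ, Δ_Θ)` -/

/-- **No `n`-torsion in `H¹(Δ_Θ, Δ_Θ)`** (`n ≠ 0`) under the origin guard: `Δ_Θ` centralises itself and is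
torsion-free (abc-iut-L2-t8 `deltaTheta_torsionfree`). [cite: MochizukiEtTh2009, Prop 1.5 (i) p.23] -/
theorem h1Theta_deltaTheta_eq_one_of_pow_eq_one (hO : D.IsEtThOrigin) {n : ℕ} (hn : n ≠ 0)
    (c : D.H1Theta D.DeltaTheta) (hc : c ^ n = 1) : c = 1 := by
  refine ContH1.eq_one_of_pow_eq_one_of_conj_trivial (fun h a => ?_) (fun a ha => ?_) c hc
  · apply Subtype.ext
    rw [MulAut.conjNormal_apply, MonoidHom.id_apply]
    exact D.deltaTheta_conj_eq_of_mem h.1 h.2 a.1 a.2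
  · apply Subtype.ext
    have hn' : (a : D.GtpTheta) ^ n = 1 := by
      have := congrArg Subtype.val ha
      simpa using this
    exact D.deltaTheta_torsionfree hO a.2 hn hn'

/-- **`log(Θ)ⁿ ≠ 1` for `n ≠ 0`.** [cite: MochizukiEtTh2009, Prop 1.5 (i) p.23] -/
theorem logTheta_pow_ne_one (hO : D.IsEtThOrigin) {n : ℕ} (hn : n ≠ 0) : D.logTheta ^ n ≠ 1 := fun h =>
  D.logTheta_ne_one hO (D.h1Theta_deltaTheta_eq_one_of_pow_eq_one hO hn _ h)

/-- **`log(Θ)` has infinite order**: `log(Θ)ⁿ = 1 ↔ n = 0` for `n : ℤ`. [cite: MochizukiEtTh2009, Prop 1.5 (i) p.23] -/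
theorem logTheta_zpow_eq_one_iff (hO : D.IsEtThOrigin) (n : ℤ) : D.logTheta ^ n = 1 ↔ n = 0 := by
  refine ⟨fun h => ?_, fun h => by rw [h, zpow_zero]⟩
  rcases Int.natAbs_eq n with hn | hn
  · rw [hn, zpow_natCast] at h
    by_contra hne
    exact D.logTheta_pow_ne_one hO (by omega) h
  · rw [hn, zpow_neg, inv_eq_one, zpow_natCast] at h
    by_contra hne
    exact D.logTheta_pow_ne_one hO (by omega) h

/-! ### Prop. 1.5 (ii) as typed (F-2503): `(K̈^×)^∧` is constrained -/

namespace KummerData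

variable (K : D.KummerData)

/-- **F-2503, relative countermodel from (ii) alone**: if Prop. 1.5 (ii) as typed holds for `K`, then it FAILS
for the Kummer datum obtained by enlarging `(K̈^×)^∧` to `(K̈^×)^∧ × ℤ` with `kumYdd (x, n) := kumYdd x · dⁿ`,
`d` a lift of `log(Θ)` to `H¹((Π^tp_Ÿ)^Θ, Δ_Θ)` ((ii)'s surjectivity): injective because `F̈² ⊆ F̈¹` and `log(Θ)`
has infinite order; `d` lies in the new range but not in `F̈²`. [cite: MochizukiEtTh2009, Prop 1.5 (ii) p.23] -/
theorem exists_kummerData_not_prop15ii (hC : D.Compat) (hO : D.IsEtThOrigin) (h : Prop15ii K hC) :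
    ∃ K' : D.KummerData, ¬ Prop15ii K' hC := by
  -- the restriction `H¹((Π^tp_Ÿ)^Θ, Δ_Θ) → H¹(Δ_Θ, Δ_Θ)`, typed over `GtpYdd`
  have hle : D.DeltaTheta ≤ D.GtpYdd.map D.toTheta :=
    hC.deltaTheta_le_DtpYddTheta.trans (Subgroup.map_mono inf_le_left)
  obtain ⟨d, hd'⟩ : ∃ d : D.H1Theta (D.GtpYdd.map D.toTheta),
      ContH1.res (MonoidHom.id D.GtpTheta) D.DeltaTheta hle d = D.logTheta :=
    h.res_deltaTheta_surjective D.logTheta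
  -- Kummer classes restrict trivially to `Δ_Θ` (`F̈² ⊆ F̈¹`)
  have hkum : ∀ x : K.KddHat, ContH1.res (MonoidHom.id D.GtpTheta) D.DeltaTheta hle (K.kumYdd x) = 1 := by
    intro x
    have hx : K.kumYdd x ∈ (Fdd2 : Subgroup (D.H1Theta (D.GtpYdd.map D.toTheta))) := by
      rw [h.Fdd2_eq]
      exact ⟨x, rfl⟩
    exact MonoidHom.mem_ker.mp (Fdd2_le_Fdd1 hC hx)
  -- the enlarged datum
  refine ⟨{ K with
            KddHat := K.KddHat × Multiplicative ℤ
            instGroupKddHat := inferInstance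
            toKddHat := K.toKddHat.prod 1
            toKddHat_injective := fun x y hxy => K.toKddHat_injective (congrArg Prod.fst hxy)
            hatIncl := K.hatIncl.prod 1
            hatIncl_toKHat := fun x y hxy => by
              rw [MonoidHom.prod_apply, MonoidHom.prod_apply, K.hatIncl_toKHat x y hxy, MonoidHom.one_apply,
                MonoidHom.one_apply]
            kumYdd := MonoidHom.coprod K.kumYdd (zpowersHom _ d)
            kumYdd_injective := ?_
            res_kumY := fun x => by
              rw [MonoidHom.prod_apply, MonoidHom.coprod_apply, MonoidHom.one_apply, map_one, mul_one]
              exact K.res_kumY x }, fun h' => ?_⟩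
  · -- injectivity of the extended `kumYdd`
    rintro ⟨x, m⟩ ⟨y, n⟩ hxy
    simp only [MonoidHom.coprod_apply, zpowersHom_apply] at hxy
    -- restrict to `Δ_Θ`: `log(Θ)^m = log(Θ)^n`
    have hmn : Multiplicative.toAdd m = Multiplicative.toAdd n := by
      have h1 := congrArg (ContH1.res (MonoidHom.id D.GtpTheta) D.DeltaTheta hle) hxy
      rw [map_mul, map_mul, hkum, hkum, one_mul, one_mul, map_zpow, map_zpow, hd'] at h1
      have h2 : D.logTheta ^ (Multiplicative.toAdd m - Multiplicative.toAdd n) = 1 := by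
        rw [zpow_sub, h1, mul_inv_cancel]
      have := (D.logTheta_zpow_eq_one_iff hO _).mp h2
      omega
    have hm : m = n := Multiplicative.toAdd.injective hmn
    subst hm
    have hx : K.kumYdd x = K.kumYdd y := mul_right_cancel hxy
    exact Prod.ext (K.kumYdd_injective hx) rfl
  · -- `d` lies in the new range, hence in `F̈² ⊆ F̈¹`: `log(Θ) = 1`
    have hdmem : d ∈ (Fdd2 : Subgroup (D.H1Theta (D.GtpYdd.map D.toTheta))) := by
      rw [h'.Fdd2_eq]
      refine ⟨(1, Multiplicative.ofAdd 1), ?_⟩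
      rw [MonoidHom.coprod_apply, map_one, one_mul, zpowersHom_apply, toAdd_ofAdd, zpow_one]
    have h1 : ContH1.res (MonoidHom.id D.GtpTheta) D.DeltaTheta hle d = 1 :=
      MonoidHom.mem_ker.mp (Fdd2_le_Fdd1 hC hdmem)
    exact D.logTheta_ne_one hO (hd'.symm.trans h1)

end KummerData

variable (D) in
/-- **F-2503, exact reduction (from (ii) alone)**: under the origin guard, Prop. 1.5 (ii) as typed holds for ALL
Kummer data over `D` iff `D` carries NO Kummer data. [cite: MochizukiEtTh2009, Prop 1.5 (ii) p.23] -/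
theorem forall_prop15ii_iff_isEmpty_kummerData (hC : D.Compat) (hO : D.IsEtThOrigin) :
    (∀ K : D.KummerData, Prop15ii K hC) ↔ IsEmpty D.KummerData := by
  refine ⟨fun h => ⟨fun K => ?_⟩, fun h K => (h.false K).elim⟩
  obtain ⟨K', hK'⟩ := K.exists_kummerData_not_prop15ii hC hO (h K)
  exact hK' (h K')

variable (D) in
/-- Dually: under the origin guard, some Kummer datum violates Prop. 1.5 (ii) as typed iff `D` carries Kummer
data. [cite: MochizukiEtTh2009, Prop 1.5 (ii) p.23] -/
theorem exists_not_prop15ii_iff_nonempty_kummerData (hC : D.Compat) (hO : D.IsEtThOrigin) :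
    (∃ K : D.KummerData, ¬ Prop15ii K hC) ↔ Nonempty D.KummerData := by
  refine ⟨fun ⟨K, _⟩ => ⟨K⟩, fun ⟨K⟩ => ?_⟩
  by_cases hK : Prop15ii K hC
  · exact K.exists_kummerData_not_prop15ii hC hO hK
  · exact ⟨K, hK⟩

/-- **F-2503, the universal closure** (guarded): Prop. 1.5 (ii) as typed holds for all primes, all theta settings
at an [EtTh] origin with `Compat`, and all Kummer data iff no such setting carries Kummer data.
[cite: MochizukiEtTh2009, Prop 1.5 (ii) p.23] -/
theorem forall_prop15ii_iff_forall_isEmpty_kummerData :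
    (∀ (p : ℕ) [Fact p.Prime] (D : ThetaSetting p) (hC : D.Compat) (_ : D.IsEtThOrigin) (K : D.KummerData),
        Prop15ii K hC) ↔
      ∀ (p : ℕ) [Fact p.Prime] (D : ThetaSetting p), D.Compat → D.IsEtThOrigin → IsEmpty D.KummerData :=
  ⟨fun h p _ D hC hO => (D.forall_prop15ii_iff_isEmpty_kummerData hC hO).mp (h p D hC hO),
    fun h p _ D hC hO => (D.forall_prop15ii_iff_isEmpty_kummerData hC hO).mpr (h p D hC hO)⟩

/-- The three closures of Prop. 1.5 (i), (ii), (iii) as typed are pairwise EQUIVALENT (each says: no Kummer data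
at any guarded setting). [cite: MochizukiEtTh2009, Prop 1.5 p.23] -/
theorem forall_prop15ii_iff_forall_prop15i :
    (∀ (p : ℕ) [Fact p.Prime] (D : ThetaSetting p) (hC : D.Compat) (_ : D.IsEtThOrigin) (K : D.KummerData),
        Prop15ii K hC) ↔
      ∀ (p : ℕ) [Fact p.Prime] (D : ThetaSetting p) (hC : D.Compat) (_ : D.IsEtThOrigin) (K : D.KummerData),
        Prop15i K hC :=
  forall_prop15ii_iff_forall_isEmpty_kummerData.trans forall_prop15i_iff_forall_isEmpty_kummerData.symm

end ThetaSetting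

end Literature.AnabelianGeometry.EtaleTheta

end
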